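import Literature.MathematicalPhysics.QuantumFieldTheory.Balaban1983to89.B16RatioResummationItems

/-!
# `Balaban1983to89.B16RatioResummation` — **a hard-core gas decorated by hole polymers, divided by its vacuum gas, is a hard-core gas of
# HOLE-ANCHORED polymers**: the RATIO form of the component resummation (1.90)–(1.91) of [Balaban1989LargeFieldII] pp. 387–388 with
# [KoteckyPreiss1986] (5), for subset polymers, in the format consumed by the `T³` Yang–Mills tower (compatible families COVERING marked points)

Third of four files (definitions `…Defs`; item lemmas and the ratio step `…Items`; properties `…Props`).

THE STATEMENT (`decorated_gas_eq_vacuum_mul_holeAnchored`).  For a Kotecký–Preiss catalogue `Λ` of non-empty vacuum polymers (activities `v`),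
admissible non-empty hole polymers (predicate `adm`, activities `h`) and marked points `Q`:
`Σ_{S : IsHoleFamily adm Q S} (Π_{X∈S} h X) · Ξ_v(vacCompat Λ S) = Ξ_v(Λ) · Σ_{𝒴 : IsChainFamily adm Λ Q 𝒴} Π_{Y∈𝒴} holeAct adm Λ Q h v Y`,
where `IsHoleFamily` = compatible ∧ covering `Q` ∧ admissible and `IsChainFamily` = compatible ∧ covering `Q` ∧ hole chains.  Print: *"For the
fixed decomposition we resum all the expressions determining the same components. We obtain the following polymer expansion (1.90) … where the
activities F(X′) are defined by (1.91)"* (p. 388) — here for the RATIO by the vacuum gas, whose clusters not attached to a hole polymer cancel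
([KoteckyPreiss1986] (5)).

PROOF ROUTE.  Step 0 `decorated_sum_eq_sum_items`: (hole family, family of attached clusters) ↔ item family (`Finset.sumEquiv`, `Finset.subtype`);
Step 1 `sum_cov_termW_eq_sum_compFamilies`: item families ↔ families of components (sibling `lcomps` ∕ `prod_lcomps` with `linkMul_termW`), the
covering clause carried along; Step 2 `cov_prod_eq_gcov_prod`: the covering clause SPLITS into «footprints cover `Q`» and per-component local clauses
(distinct components have disjoint footprints, `disjoint_fp_of_isCompFamily`); Step 3 `sum_compFamilies_eq_sum_footprints`: resummation at fixed
footprints (sibling `sum_fiber_eq_prod_F`); Step 4 `sum_footprints_eq_sum_holeChains`: the index set is the compatible covering families of hole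
chains (other footprints carry zero activity, `holeAct_eq_zero_of_not_isHoleChain`; the two hard cores agree, `isCompatible_pinc_iff`).

NOT CLAIMED: bounds on `holeAct` ((1.97)-type activity estimates are a separate task); anything analytic.  No `sorry`; no definitions; no named fact.

References: [Balaban1989LargeFieldII] T. Bałaban, *Large field renormalization. II. Localization, exponentiation, and bounds for the
𝐑 operation*, Commun. Math. Phys. **122** (1989) 355–392, pp. 387–388 (1.90)–(1.91); [KoteckyPreiss1986] R. Kotecký, D. Preiss, *Cluster
expansion for abstract polymer models*, Commun. Math. Phys. **103** (1986) 491–498, (5) and Theorem p. 492; [Dimock2013BalabanII] J. Dimock,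
*The renormalization group according to Balaban II. Large fields*, J. Math. Phys. **54** (2013) 092301, App. F (the same resummation for
scalar fields, template only).
-/

namespace Literature.MathematicalPhysics.QuantumFieldTheory.Balaban1983to89.B16RatioResummation

open Classical
open Finset
open Literature.Probability.LatticeModels
open Literature.MathematicalPhysics.QuantumFieldTheory.Balaban1983to89.B16Eq190Resummation

noncomputable section

variable {α : Type*} [DecidableEq α]

/-! ## Part D. The component resummation with the covering clause ((1.90) for the decorated sum) -/

section ItemLevel

variable [Fintype α]

omit [Fintype α] in
/-- `toLeft` of a union of families. [folklore] -/
private theorem toLeft_biUnion (Ps : Finset (Finset (Item α))) : (Ps.biUnion id).toLeft = Ps.biUnion fun C => C.toLeft := by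
  ext X; simp

/-- **Step 1 — from item families to families of components**, carrying the covering clause:
`Σ_T [cover] W(T) = Σ_{Ps} [cover of ⋃Ps] Π_{C∈Ps} W(C)`. [cite: Balaban1989LargeFieldII, (1.90) p.388] -/
theorem sum_cov_termW_eq_sum_compFamilies (adm : Finset α → Prop) (Λ : Finset (Finset α)) (Q : Finset α) (h v : Finset α → ℂ) :
    ∑ T : Finset (Item α), (if HCov Q T.toLeft then termW adm Λ h v T else 0) =
      ∑ Ps ∈ compFamilies (link (α := α)),
        (if HCov Q (Ps.biUnion id).toLeft then ∏ C ∈ Ps, termW adm Λ h v C else 0) := by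
  refine Finset.sum_nbij' (lcomps link) (fun Ps => Ps.biUnion id) (fun T _ => ?_) (fun _ _ => Finset.mem_univ _)
    (fun T _ => biUnion_lcomps T) (fun Ps hPs => (mem_compFamilies.1 hPs).lcomps_biUnion) (fun T _ => ?_)
  · exact mem_compFamilies.2 (isCompFamily_lcomps link_symm T)
  · rw [biUnion_lcomps, prod_lcomps link_symm (termW_empty adm Λ h v) (linkMul_termW adm Λ h v) T]

omit [Fintype α] in
/-- Distinct members of a family of components have DISJOINT footprints (no link = no common point).
[cite: Balaban1989LargeFieldII, (1.90) p.388] -/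
theorem disjoint_fp_of_isCompFamily {Ps : Finset (Finset (Item α))} (hPs : IsCompFamily link Ps) {C C' : Finset (Item α)}
    (hC : C ∈ Ps) (hC' : C' ∈ Ps) (hne : C ≠ C') : Disjoint (fp loc C) (fp loc C') := by
  rw [Finset.disjoint_left]
  intro a ha ha'
  simp only [fp, mem_biUnion] at ha ha'
  obtain ⟨u, hu, hau⟩ := ha
  obtain ⟨w, hw, haw⟩ := ha'
  exact hPs.2 C hC C' hC' hne u hu w hw ((link_iff u w).2 ⟨a, mem_inter.2 ⟨hau, haw⟩⟩)

omit [Fintype α] in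
/-- A hole item's polymer lies inside the footprint of its family. [cite: Balaban1989LargeFieldII, (1.91) p.388] -/
theorem subset_fp_of_mem_toLeft {C : Finset (Item α)} {X : HItem α} (hX : X ∈ C.toLeft) : X.1 ⊆ fp loc C := by
  intro a ha
  simp only [fp, mem_biUnion]
  exact ⟨Sum.inl X, mem_toLeft.1 hX, by simpa [loc] using ha⟩

/-- **Step 2 — the covering clause splits**: over a family of components, «the hole items of ⋃Ps cover `Q`» ⟺ «the footprints cover
`Q`» ∧ «each component covers the marked points inside its footprint» (distinct components have disjoint footprints); the local
clauses enter the component weights. [cite: Balaban1989LargeFieldII, (1.90) p.388] -/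
theorem cov_prod_eq_gcov_prod {adm : Finset α → Prop} {Λ : Finset (Finset α)} {Q : Finset α} {h v : Finset α → ℂ}
    {Ps : Finset (Finset (Item α))} (hPs : IsCompFamily link Ps) :
    (if HCov Q (Ps.biUnion id).toLeft then ∏ C ∈ Ps, termW adm Λ h v C else 0) =
      (if GCov Q (Ps.image (fp loc)) then ∏ C ∈ Ps, termWCov adm Λ Q h v C else 0) := by
  by_cases hloc : ∀ C ∈ Ps, LocCov Q C
  · have hprod : ∏ C ∈ Ps, termWCov adm Λ Q h v C = ∏ C ∈ Ps, termW adm Λ h v C :=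
      Finset.prod_congr rfl fun C hC => by rw [termWCov, if_pos (hloc C hC)]
    rw [hprod]
    have hiff : HCov Q (Ps.biUnion id).toLeft ↔ GCov Q (Ps.image (fp loc)) := by
      constructor
      · intro hc b hb
        obtain ⟨X, hX, hbX⟩ := hc b hb
        rw [toLeft_biUnion, mem_biUnion] at hX
        obtain ⟨C, hC, hXC⟩ := hX
        exact ⟨fp loc C, mem_image_of_mem _ hC, subset_fp_of_mem_toLeft hXC hbX⟩
      · intro hc b hb
        obtain ⟨Y, hY, hbY⟩ := hc b hb
        obtain ⟨C, hC, rfl⟩ := mem_image.1 hY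
        obtain ⟨X, hX, hbX⟩ := hloc C hC b hb hbY
        exact ⟨X, by rw [toLeft_biUnion, mem_biUnion]; exact ⟨C, hC, hX⟩, hbX⟩
    simp only [hiff]
  · push Not at hloc
    obtain ⟨C₀, hC₀, hfail⟩ := hloc
    have hR : ∏ C ∈ Ps, termWCov adm Λ Q h v C = 0 :=
      Finset.prod_eq_zero hC₀ (by rw [termWCov, if_neg hfail])
    have hL : ¬ HCov Q (Ps.biUnion id).toLeft := by
      intro hc
      apply hfail
      intro b hb hbC₀
      obtain ⟨X, hX, hbX⟩ := hc b hb
      rw [toLeft_biUnion, mem_biUnion] at hX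
      obtain ⟨C₁, hC₁, hXC₁⟩ := hX
      by_cases h01 : C₀ = C₁
      · subst h01; exact ⟨X, hXC₁, hbX⟩
      · exact absurd hbC₀ (Finset.disjoint_right.1 (disjoint_fp_of_isCompFamily hPs hC₀ hC₁ h01) (subset_fp_of_mem_toLeft hXC₁ hbX))
    rw [if_neg hL, hR, ite_self]

/-- **Step 3 — resummation at fixed footprints** (the sibling's `sum_fiber_eq_prod_F`): the families of components with footprint family
`𝒴` contribute `Π_{Y∈𝒴} ζ(Y)`. [cite: Balaban1989LargeFieldII, (1.90) p.388] -/
theorem sum_compFamilies_eq_sum_footprints (adm : Finset α → Prop) (Λ : Finset (Finset α)) (Q : Finset α) (h v : Finset α → ℂ) :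
    ∑ Ps ∈ compFamilies (link (α := α)), (if GCov Q (Ps.image (fp loc)) then ∏ C ∈ Ps, termWCov adm Λ Q h v C else 0) =
      ∑ 𝒴 ∈ (polys (fun a b : α => a = b) loc ∅).powerset.filter (IsCompatible (pinc (fun a b : α => a = b) ∅)),
        (if GCov Q 𝒴 then ∏ Y ∈ 𝒴, holeAct adm Λ Q h v Y else 0) := by
  rw [← Finset.sum_fiberwise_of_maps_to (g := fun Ps : Finset (Finset (Item α)) => Ps.image (fp loc))
      (t := (polys (fun a b : α => a = b) loc ∅).powerset.filter (IsCompatible (pinc (fun a b : α => a = b) ∅)))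
      (fun Ps hPs => image_fp_mem (mem_compFamilies.1 hPs))]
  refine Finset.sum_congr rfl fun 𝒴 h𝒴 => ?_
  have hfib : ∀ Ps ∈ (compFamilies (link (α := α))).filter (fun Ps => Ps.image (fp loc) = 𝒴),
      (if GCov Q (Ps.image (fp loc)) then ∏ C ∈ Ps, termWCov adm Λ Q h v C else 0) =
        (if GCov Q 𝒴 then ∏ C ∈ Ps, termWCov adm Λ Q h v C else 0) := fun Ps hPs => by
    rw [(mem_filter.1 hPs).2]
  rw [Finset.sum_congr rfl hfib]
  by_cases hG : GCov Q 𝒴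
  · simp only [if_pos hG]
    exact sum_fiber_eq_prod_F (fun _ => rfl) (fun _ _ h => h.symm) loc_nonempty _ 𝒴 (mem_filter.1 h𝒴).2
  · simp only [if_neg hG, sum_const_zero]

omit [Fintype α] in
/-- The hard cores agree: compatibility for «footprints meet» is compatibility for `polyInc` (distinct members). [cite: Balaban1989LargeFieldII, (1.90) p.388] -/
theorem isCompatible_pinc_iff (𝒴 : Finset (Finset α)) :
    IsCompatible (pinc (fun a b : α => a = b) ∅) 𝒴 ↔ IsCompatible polyInc 𝒴 := by
  have key : ∀ Y Y' : Finset α, Y ≠ Y' → (pinc (fun a b : α => a = b) ∅ Y Y' ↔ polyInc Y Y') := by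
    intro Y Y' hne
    simp only [pinc, Touch, sdiff_empty, polyInc, Finset.Nonempty, mem_inter]
    constructor
    · rintro ⟨a, ha, b, hb, rfl⟩; exact Or.inr ⟨a, ha, hb⟩
    · rintro (h | ⟨a, ha, hb⟩)
      · exact absurd h hne
      · exact ⟨a, ha, a, hb, rfl⟩
  simp only [isCompatible_iff]
  exact ⟨fun H Y hY Y' hY' hne => by rw [← key Y Y' hne]; exact H Y hY Y' hY' hne,
    fun H Y hY Y' hY' hne => by rw [key Y Y' hne]; exact H Y hY Y' hY' hne⟩

/-- A footprint that is not a hole chain carries ZERO activity: every connected term with that footprint violates a support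
condition. [cite: Balaban1989LargeFieldII, (1.91) p.388] -/
theorem holeAct_eq_zero_of_not_isHoleChain {adm : Finset α → Prop} {Λ : Finset (Finset α)} {Q : Finset α} {h v : Finset α → ℂ}
    {Y : Finset α} (hY : ¬ IsHoleChain adm Λ Y) : holeAct adm Λ Q h v Y = 0 := by
  classical
  unfold holeAct F
  refine Finset.sum_eq_zero fun C hC => ?_
  obtain ⟨hconn, hfp⟩ := mem_fibC.1 hC
  unfold termWCov termW
  split_ifs with hcov hok
  · exfalso
    refine hY ⟨C, hconn, hfp, ?_, hok.1, fun D hD => ⟨(hok.2.2 D hD).1, (hok.2.2 D hD).2.1⟩⟩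
    by_contra hempty
    rw [Finset.not_nonempty_iff_eq_empty] at hempty
    obtain ⟨u, hu⟩ := hconn.1
    rcases u with X | D
    · have : X ∈ C.toLeft := mem_toLeft.2 hu
      rw [hempty] at this; exact Finset.notMem_empty _ this
    · obtain ⟨-, -, X, hX, -⟩ := hok.2.2 D (mem_toRight.2 hu)
      rw [hempty] at hX; exact Finset.notMem_empty _ hX
  · rfl
  · rfl

/-- A hole chain is a polymer of the sibling's catalogue. [cite: Balaban1989LargeFieldII, (1.90) p.388] -/
theorem mem_polys_of_isHoleChain {adm : Finset α → Prop} {Λ : Finset (Finset α)} {Y : Finset α} (hY : IsHoleChain adm Λ Y) :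
    Y ∈ polys (fun a b : α => a = b) loc ∅ := by
  obtain ⟨T, hT, hfp, -⟩ := hY
  exact mem_polys.2 ⟨T, hT, hfp⟩

/-- **Step 4 — the index set of the hole-anchored gas**: compatible (for `polyInc`) families of HOLE CHAINS covering `Q`.
[cite: Balaban1989LargeFieldII, (1.90) p.388] -/
theorem sum_footprints_eq_sum_holeChains (adm : Finset α → Prop) (Λ : Finset (Finset α)) (Q : Finset α) (h v : Finset α → ℂ) :
    ∑ 𝒴 ∈ (polys (fun a b : α => a = b) loc ∅).powerset.filter (IsCompatible (pinc (fun a b : α => a = b) ∅)),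
        (if GCov Q 𝒴 then ∏ Y ∈ 𝒴, holeAct adm Λ Q h v Y else 0) =
      ∑ 𝒴 ∈ (Finset.univ : Finset (Finset α)).powerset.filter (IsChainFamily adm Λ Q),
        ∏ Y ∈ 𝒴, holeAct adm Λ Q h v Y := by
  rw [← Finset.sum_filter]
  symm
  refine Finset.sum_subset (fun 𝒴 h𝒴 => ?_) (fun 𝒴 h𝒴 hnot => ?_)
  · obtain ⟨-, hcomp, hcov, hchain⟩ := mem_filter.1 h𝒴
    exact mem_filter.2 ⟨mem_filter.2 ⟨mem_powerset.2 fun Y hY => mem_polys_of_isHoleChain (hchain Y hY),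
      (isCompatible_pinc_iff 𝒴).2 hcomp⟩, hcov⟩
  · obtain ⟨h1, hcov⟩ := mem_filter.1 h𝒴
    obtain ⟨-, hcomp⟩ := mem_filter.1 h1
    have : ¬ ∀ Y ∈ 𝒴, IsHoleChain adm Λ Y := fun hall =>
      hnot (mem_filter.2 ⟨mem_powerset.2 (subset_univ _), ⟨(isCompatible_pinc_iff 𝒴).1 hcomp, hcov, hall⟩⟩)
    push Not at this
    obtain ⟨Y, hY, hYn⟩ := this
    exact Finset.prod_eq_zero hY (holeAct_eq_zero_of_not_isHoleChain hYn)

end ItemLevel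

/-! ## Part E. From hole families and attached clusters to item families, and the main identity -/

section Main

variable [Fintype α]

omit [DecidableEq α] in
/-- Finite families of a subtype are the finite families all of whose members satisfy the predicate. [folklore] -/
private theorem sum_finset_subtype_eq {β : Type*} [DecidableEq β] [Fintype β] (p : β → Prop) [DecidablePred p] {M : Type*}
    [AddCommMonoid M] (g : Finset β → M) :
    ∑ S' : Finset {x // p x}, g (S'.map (Function.Embedding.subtype p)) =
      ∑ S ∈ (Finset.univ : Finset β).powerset.filter (fun S => ∀ x ∈ S, p x), g S := by
  refine Finset.sum_nbij' (fun S' => S'.map (Function.Embedding.subtype p)) (fun S => S.subtype p) ?_ ?_ ?_ ?_ ?_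
  · intro S' _
    exact mem_filter.2 ⟨mem_powerset.2 (subset_univ _), fun x hx => property_of_mem_map_subtype S' hx⟩
  · intro S _; exact mem_univ _
  · intro S' _
    ext x
    simp only [mem_subtype, mem_map, Function.Embedding.coe_subtype]
    exact ⟨fun ⟨y, hy, hyx⟩ => by rwa [← Subtype.ext hyx], fun hx => ⟨x, hx, rfl⟩⟩
  · intro S hS; exact subtype_map_of_mem (mem_filter.1 hS).2
  · intro S' _; rfl

/-- The term weight of a term given by its two halves. [cite: Balaban1989LargeFieldII, (1.91) p.388] -/
theorem termW_disjSum (adm : Finset α → Prop) (Λ : Finset (Finset α)) (h v : Finset α → ℂ) (S' : Finset (HItem α))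
    (D' : Finset (CItem α)) :
    termW adm Λ h v (S'.disjSum D') =
      if (∀ X ∈ S', adm X.1) ∧ (∀ X ∈ S', ∀ X' ∈ S', X ≠ X' → ¬ polyInc X.1 X'.1) ∧
          (∀ C ∈ D', C.1 ⊆ Λ ∧ IsPolymerCluster polyInc C.1 ∧ ∃ X ∈ S', ∃ γ ∈ C.1, polyInc γ X.1)
      then (∏ X ∈ S', h X.1) * ∏ C ∈ D', mayerU v C.1 else 0 := by
  unfold termW TermOk
  simp only [toLeft_disjSum, toRight_disjSum]

/-- The attached clusters, lifted to cluster items. [cite: KoteckyPreiss1986, (5)] -/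
theorem map_filter_eq_attached {Λ : Finset (Finset α)} (hΛ : ∀ γ ∈ Λ, γ.Nonempty) (S' : Finset (HItem α))
    [DecidablePred fun C : CItem α => C.1 ⊆ Λ ∧ IsPolymerCluster polyInc C.1 ∧ ∃ X ∈ S', ∃ γ ∈ C.1, polyInc γ X.1] :
    (Finset.univ.filter fun C : CItem α => C.1 ⊆ Λ ∧ IsPolymerCluster polyInc C.1 ∧ ∃ X ∈ S', ∃ γ ∈ C.1, polyInc γ X.1).map
        (Function.Embedding.subtype _) =
      attached Λ (S'.map (Function.Embedding.subtype _)) := by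
  ext C
  simp only [mem_map, mem_filter, mem_univ, true_and, Function.Embedding.coe_subtype, mem_attached]
  constructor
  · rintro ⟨C', ⟨hΛ', hcl, X, hX, γ, hγ, hγX⟩, rfl⟩
    exact ⟨hΛ', ⟨γ, hγ, X.1, ⟨X, hX, rfl⟩, hγX⟩, hcl⟩
  · rintro ⟨hCΛ, ⟨γ, hγ, X, hX, hγX⟩, hcl⟩
    obtain ⟨X', hX', rfl⟩ := hX
    have hne : C.Nonempty ∧ ∀ γ ∈ C, γ.Nonempty := ⟨⟨γ, hγ⟩, fun γ' hγ' => hΛ γ' (hCΛ hγ')⟩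
    exact ⟨⟨C, hne⟩, ⟨hCΛ, hcl, X', hX', γ, hγ, hγX⟩, rfl⟩

/-- The sum over families of attached cluster items is the Mayer sum over the attached clusters. [cite: KoteckyPreiss1986, (5)] -/
theorem sum_clusterItems_eq {Λ : Finset (Finset α)} (hΛ : ∀ γ ∈ Λ, γ.Nonempty) (v : Finset α → ℂ) (S' : Finset (HItem α)) :
    ∑ D' : Finset (CItem α),
        (if ∀ C ∈ D', C.1 ⊆ Λ ∧ IsPolymerCluster polyInc C.1 ∧ ∃ X ∈ S', ∃ γ ∈ C.1, polyInc γ X.1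
          then ∏ C ∈ D', mayerU v C.1 else 0) =
      ∑ D ∈ (attached Λ (S'.map (Function.Embedding.subtype _))).powerset, ∏ C ∈ D, mayerU v C := by
  set P : CItem α → Prop := fun C => C.1 ⊆ Λ ∧ IsPolymerCluster polyInc C.1 ∧ ∃ X ∈ S', ∃ γ ∈ C.1, polyInc γ X.1 with hP
  have hset : (Finset.univ : Finset (Finset (CItem α))).filter (fun D' => ∀ C ∈ D', P C) = (Finset.univ.filter P).powerset := by
    ext D'
    simp only [mem_filter, mem_univ, true_and, mem_powerset, subset_iff]
  rw [← Finset.sum_filter, hset, ← Finset.prod_one_add, ← Finset.prod_one_add,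
    ← map_filter_eq_attached hΛ S', Finset.prod_map]
  rfl

/-- The inner sums of a fixed hole-item family. [cite: Balaban1989LargeFieldII, (1.90) p.388] -/
theorem sum_disjSum_eq {adm : Finset α → Prop} {Λ : Finset (Finset α)} (hΛ : ∀ γ ∈ Λ, γ.Nonempty) (Q : Finset α)
    (h v : Finset α → ℂ) (S' : Finset (HItem α)) :
    ∑ D' : Finset (CItem α), (if HCov Q S' then termW adm Λ h v (S'.disjSum D') else 0) =
      if HCov Q S' ∧ (∀ X ∈ S', adm X.1) ∧ (∀ X ∈ S', ∀ X' ∈ S', X ≠ X' → ¬ polyInc X.1 X'.1) then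
        (∏ X ∈ S', h X.1) * ∑ D ∈ (attached Λ (S'.map (Function.Embedding.subtype _))).powerset, ∏ C ∈ D, mayerU v C
      else 0 := by
  simp only [termW_disjSum]
  by_cases hc : HCov Q S'
  · by_cases hA : (∀ X ∈ S', adm X.1) ∧ (∀ X ∈ S', ∀ X' ∈ S', X ≠ X' → ¬ polyInc X.1 X'.1)
    · rw [if_pos ⟨hc, hA⟩, ← sum_clusterItems_eq hΛ v S', Finset.mul_sum]
      refine Finset.sum_congr rfl fun D' _ => ?_
      rw [if_pos hc]
      by_cases hD : ∀ C ∈ D', C.1 ⊆ Λ ∧ IsPolymerCluster polyInc C.1 ∧ ∃ X ∈ S', ∃ γ ∈ C.1, polyInc γ X.1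
      · rw [if_pos ⟨hA.1, hA.2, hD⟩, if_pos hD]
      · rw [if_neg (fun H => hD H.2.2), if_neg hD, mul_zero]
    · rw [if_neg (fun H => hA H.2)]
      refine Finset.sum_eq_zero fun D' _ => ?_
      rw [if_pos hc, if_neg (fun H => hA ⟨H.1, H.2.1⟩)]
  · rw [if_neg (fun H => hc H.1)]
    exact Finset.sum_eq_zero fun D' _ => by rw [if_neg hc]

/-- The hole-item conditions, read on the underlying hole family. [cite: Balaban1989LargeFieldII, (1.90) p.388] -/
theorem holeItem_conditions_iff (adm : Finset α → Prop) (Q : Finset α) (S' : Finset (HItem α)) :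
    (HCov Q S' ∧ (∀ X ∈ S', adm X.1) ∧ (∀ X ∈ S', ∀ X' ∈ S', X ≠ X' → ¬ polyInc X.1 X'.1)) ↔
      IsHoleFamily adm Q (S'.map (Function.Embedding.subtype _)) := by
  have h1 : HCov Q S' ↔ GCov Q (S'.map (Function.Embedding.subtype _)) := by
    simp only [HCov, GCov, mem_map, Function.Embedding.coe_subtype]
    constructor
    · intro H b hb; obtain ⟨X, hX, hbX⟩ := H b hb; exact ⟨X.1, ⟨X, hX, rfl⟩, hbX⟩
    · intro H b hb; obtain ⟨Y, ⟨X, hX, rfl⟩, hbX⟩ := H b hb; exact ⟨X, hX, hbX⟩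
  have h2 : (∀ X ∈ S', adm X.1) ↔ ∀ X ∈ S'.map (Function.Embedding.subtype _), adm X := by
    simp only [mem_map, Function.Embedding.coe_subtype, forall_exists_index, and_imp]
    constructor
    · rintro H Y X hX rfl; exact H X hX
    · intro H X hX; exact H X.1 X hX rfl
  have h3 : (∀ X ∈ S', ∀ X' ∈ S', X ≠ X' → ¬ polyInc X.1 X'.1) ↔
      IsCompatible polyInc (S'.map (Function.Embedding.subtype _)) := by
    rw [isCompatible_iff]
    simp only [mem_map, Function.Embedding.coe_subtype, forall_exists_index, and_imp]
    constructor
    · rintro H Y X hX rfl Y' X' hX' rfl hne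
      exact H X hX X' hX' (fun heq => hne (by rw [heq]))
    · intro H X hX X' hX' hne
      exact H X.1 X hX rfl X'.1 X' hX' rfl (fun heq => hne (Subtype.ext heq))
  rw [h1, h2, h3, IsHoleFamily]
  tauto

/-- **Step 0 — decorated hole families with their attached-cluster Mayer sums ARE the covered item sums.**
[cite: Balaban1989LargeFieldII, (1.90) p.388] -/
theorem decorated_sum_eq_sum_items (adm : Finset α → Prop) (hadm : ∀ X, adm X → X.Nonempty)
    {Λ : Finset (Finset α)} (hΛ : ∀ γ ∈ Λ, γ.Nonempty) (Q : Finset α) (h v : Finset α → ℂ) :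
    ∑ S ∈ (Finset.univ : Finset (Finset α)).powerset.filter (IsHoleFamily adm Q),
        (∏ X ∈ S, h X) * ∑ D ∈ (attached Λ S).powerset, ∏ C ∈ D, mayerU v C =
      ∑ T : Finset (Item α), (if HCov Q T.toLeft then termW adm Λ h v T else 0) := by
  symm
  -- item families = pairs (hole items, cluster items)
  rw [Fintype.sum_equiv Finset.sumEquiv.toEquiv _
      (fun p : Finset (HItem α) × Finset (CItem α) => if HCov Q p.1 then termW adm Λ h v (p.1.disjSum p.2) else 0)
      (fun T => by
        change _ = if HCov Q (Finset.sumEquiv T).1 then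
          termW adm Λ h v ((Finset.sumEquiv T).1.disjSum (Finset.sumEquiv T).2) else 0
        rw [Finset.sumEquiv_apply_fst, Finset.sumEquiv_apply_snd, toLeft_disjSum_toRight]),
    Fintype.sum_prod_type]
  -- the inner sums
  refine (Finset.sum_congr rfl fun S' _ => sum_disjSum_eq (adm := adm) hΛ Q h v S').trans ?_
  refine (Finset.sum_congr rfl fun S' _ => ?_).trans
    ((sum_finset_subtype_eq (β := Finset α) Finset.Nonempty (M := ℂ)
      (fun S => if IsHoleFamily adm Q S then (∏ X ∈ S, h X) * ∑ D ∈ (attached Λ S).powerset, ∏ C ∈ D, mayerU v C else 0)).trans ?_)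
  · -- the summand on the underlying hole family
    simp only [holeItem_conditions_iff adm Q S', Finset.prod_map, Function.Embedding.coe_subtype]
  · rw [← Finset.sum_filter, Finset.filter_filter]
    refine Finset.sum_congr ?_ fun _ _ => rfl
    ext S
    simp only [mem_filter, mem_powerset]
    exact ⟨fun H => ⟨H.1, H.2.2⟩, fun H => ⟨H.1, fun X hX => hadm X (H.2.2.2 X hX), H.2⟩⟩

/-- **THE RATIO RESUMMATION ((1.90)–(1.91) with [KoteckyPreiss1986] (5))**: for a Kotecký–Preiss catalogue `Λ` of non-empty vacuum
polymers and admissible non-empty hole polymers,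
`Σ_{S compatible, covering Q, admissible} (Π_{X∈S} h X)·Ξ_v(Λ compatible with S) = Ξ_v(Λ) · Σ_{𝒴 compatible, covering Q, hole chains} Π_{Y∈𝒴} ζ(Y)`.
[cite: Balaban1989LargeFieldII, (1.90)-(1.91) p.388] -/
theorem decorated_gas_eq_vacuum_mul_holeAnchored (adm : Finset α → Prop) (hadm : ∀ X, adm X → X.Nonempty)
    {Λ : Finset (Finset α)} (hΛ : ∀ γ ∈ Λ, γ.Nonempty) {v : Finset α → ℂ} {a : Finset α → ℝ} (hKP : IsKPVolume polyInc v a Λ)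
    (Q : Finset α) (h : Finset α → ℂ) :
    ∑ S ∈ (Finset.univ : Finset (Finset α)).powerset.filter (IsHoleFamily adm Q),
        (∏ X ∈ S, h X) * polymerPartitionFunction polyInc v (vacCompat Λ S) =
      polymerPartitionFunction polyInc v Λ *
        ∑ 𝒴 ∈ (Finset.univ : Finset (Finset α)).powerset.filter (IsChainFamily adm Λ Q), ∏ Y ∈ 𝒴, holeAct adm Λ Q h v Y := by
  have step : ∀ S : Finset (Finset α), (∏ X ∈ S, h X) * polymerPartitionFunction polyInc v (vacCompat Λ S) =
      polymerPartitionFunction polyInc v Λ * ((∏ X ∈ S, h X) * ∑ D ∈ (attached Λ S).powerset, ∏ C ∈ D, mayerU v C) := by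
    intro S
    rw [gas_compat_eq_mul_sum_mayer hKP S]
    ring
  rw [Finset.sum_congr rfl fun S _ => step S, ← Finset.mul_sum, decorated_sum_eq_sum_items adm hadm hΛ Q h v,
    sum_cov_termW_eq_sum_compFamilies,
    Finset.sum_congr rfl fun Ps hPs => cov_prod_eq_gcov_prod (adm := adm) (Λ := Λ) (Q := Q) (h := h) (v := v)
      (mem_compFamilies.1 hPs),
    sum_compFamilies_eq_sum_footprints, sum_footprints_eq_sum_holeChains]

end Main

end

end Literature.MathematicalPhysics.QuantumFieldTheory.Balaban1983to89.B16RatioResummation
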